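import Literature.NumberTheory.Transcendental.ProjectiveNoIsolatedPoints
import Mathlib.RingTheory.Nullstellensatz
import HarnessLib

/-!
# Philippon's criterion over Nesterenko's toolkit, III: Nullstellensatz and ranks for homogeneous primes of `ℚ[x₀, …, x_m]` — proofs only

`Literature/NumberTheory/Transcendental/PhilipponCriterionRank.lean` — proofs only (no new
definitions, nothing asserted). Third glue layer of the programme deriving
`Philippon1986_mainCriterion` (`PhilipponCriterion.lean`, Philippon 1986 Thm 2.11) from Nesterenko's
toolkit (LNM 1752 Ch. 3 §4, `NesterenkoElimination.lean`). Philippon's induction (§3) manipulates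
chains of homogeneous primes `𝔓_{N,1} ⊇ 𝔓_{N,2} ⊇ … ⊇ 𝔓` through their zero sets and their
codimensions; on Nesterenko's side the zero sets are `Nesterenko.projZeros` (non-zero complex zeros)
and the codimension is the rank `Nesterenko.IsUnmixedOfRank` (`dim ℚ[x̲] ⧸ 𝔭 = r`). This file supplies:

* `mem_of_forall_mem_projZeros_aeval_eq_zero` — the **projective Nullstellensatz over `ℚ` with
  complex points**: a polynomial without constant term vanishing at every non-zero complex zero of
  a prime `𝔮` lies in `𝔮` (Mathlib's two-field Nullstellensatz
  `MvPolynomial.vanishingIdeal_zeroLocus_eq_radical` for `ℚ ⊆ ℂ`);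
* `le_of_projZeros_subset`, `exists_le_of_projZeros_subset_biUnion` — hence `V(𝔮) ⊆ V(𝔓) ⇒ 𝔓 ⊆ 𝔮`
  and `V(𝔮) ⊆ ⋃ᵢ V(𝔭ᵢ) ⇒ 𝔭ᵢ ⊆ 𝔮` for some `i`, for ideals containing the homogeneous components of
  their elements;
* `projZeros_eq_biUnion_radical` — `V(⋂ Qᵢ) = ⋃ V(√Qᵢ)` for a (primary) decomposition;
* `ringKrullDim_quotient_add_one_le_of_lt`, `eq_of_le_of_ringKrullDim_quotient_eq` — a proper
  inclusion of primes drops `dim ℚ[x̲] ⧸ ·`, so primes of equal rank in inclusion are equal.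

## References

* [Philippon1986Criteres] P. Philippon, Publ. Math. IHÉS 64 (1986), §3 (pp. 42–48), where these
  facts are used for the ideals `𝔓_{N,r}`.
* [NesterenkoPhilippon2001] LNM 1752 (2001), Ch. 3 §4 (the invariants and `V(I)`).
-/

noncomputable section

open MvPolynomial
open Literature.NumberTheory.Transcendental.Nesterenko

namespace Literature.NumberTheory.Transcendental

namespace PhilipponMain

variable {m : ℕ}

/-! ### Constant terms of ideals containing the homogeneous components of their elements -/

/-- In a proper ideal containing the homogeneous components of its elements every element has zero
constant term. [folklore] -/
theorem constantCoeff_eq_zero_of_mem {I : Ideal (Rx m)}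
    (hI : ∀ g ∈ I, ∀ k : ℕ, homogeneousComponent k g ∈ I) (hItop : I ≠ ⊤) {a : Rx m} (ha : a ∈ I) :
    constantCoeff a = 0 := by
  by_contra h
  apply hItop
  have h0 : homogeneousComponent 0 a ∈ I := hI a ha 0
  rw [homogeneousComponent_zero] at h0
  have hunit : IsUnit (C (coeff 0 a) : Rx m) := by
    refine (IsUnit.mk0 _ ?_).map C
    rwa [← constantCoeff_eq]
  exact Ideal.eq_top_of_isUnit_mem _ h0 hunit

/-- Hence its elements vanish at the origin of `ℂ^{m+1}`. [folklore] -/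
theorem aeval_zero_eq_zero_of_mem {I : Ideal (Rx m)}
    (hI : ∀ g ∈ I, ∀ k : ℕ, homogeneousComponent k g ∈ I) (hItop : I ≠ ⊤) {a : Rx m} (ha : a ∈ I) :
    aeval (0 : Fin (m + 1) → ℂ) a = 0 := by
  rw [MvPolynomial.aeval_zero, constantCoeff_eq_zero_of_mem hI hItop ha, map_zero]

/-! ### The projective Nullstellensatz over `ℚ` with complex points -/

/-- **Nullstellensatz.** If `𝔮 ⊂ ℚ[x̲]` is prime and `a ∈ ℚ[x̲]` vanishes at the origin and at every
non-zero complex zero of `𝔮` (`projZeros 𝔮`), then `a ∈ 𝔮` (`a` vanishes on the whole complex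
zero locus of `𝔮`, whose vanishing ideal over `ℚ` is `√𝔮 = 𝔮`, Mathlib
`MvPolynomial.IsPrime.vanishingIdeal_zeroLocus`). [folklore] -/
theorem mem_of_forall_mem_projZeros_aeval_eq_zero {𝔮 : Ideal (Rx m)} (h𝔮 : 𝔮.IsPrime) {a : Rx m}
    (ha0 : aeval (0 : Fin (m + 1) → ℂ) a = 0) (hvan : ∀ β ∈ projZeros 𝔮, aeval β a = 0) : a ∈ 𝔮 := by
  haveI := h𝔮
  have h : a ∈ vanishingIdeal ℚ (zeroLocus ℂ 𝔮) := by
    rw [mem_vanishingIdeal_iff]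
    intro x hx
    by_cases hx0 : x = 0
    · rw [hx0]; exact ha0
    · exact hvan x ⟨hx0, mem_zeroLocus_iff.mp hx⟩
  rwa [MvPolynomial.IsPrime.vanishingIdeal_zeroLocus] at h

/-- **`V(𝔮) ⊆ V(𝔓) ⇒ 𝔓 ⊆ 𝔮`** for `𝔮` prime and `𝔓` a proper ideal containing the homogeneous
components of its elements. [folklore] -/
theorem le_of_projZeros_subset {𝔓 𝔮 : Ideal (Rx m)} (h𝔮 : 𝔮.IsPrime)
    (h𝔓 : ∀ g ∈ 𝔓, ∀ k : ℕ, homogeneousComponent k g ∈ 𝔓) (h𝔓top : 𝔓 ≠ ⊤)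
    (hV : projZeros 𝔮 ⊆ projZeros 𝔓) : 𝔓 ≤ 𝔮 := fun a ha =>
  mem_of_forall_mem_projZeros_aeval_eq_zero h𝔮 (aeval_zero_eq_zero_of_mem h𝔓 h𝔓top ha)
    fun _ hβ => (hV hβ).2 a ha

/-- An element outside a prime has a homogeneous component outside it. [folklore] -/
theorem exists_homogeneousComponent_not_mem {𝔮 : Ideal (Rx m)} {g : Rx m} (hg : g ∉ 𝔮) :
    ∃ k : ℕ, homogeneousComponent k g ∉ 𝔮 := by
  classical
  by_contra hall
  push Not at hall
  apply hg
  rw [← sum_homogeneousComponent g]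
  exact Ideal.sum_mem _ fun k _ => hall k

/-- **`V(𝔮) ⊆ ⋃ᵢ V(𝔭ᵢ) ⇒ 𝔭ᵢ ⊆ 𝔮` for some `i`**, for `𝔮` prime with `V(𝔮) ≠ ∅` and finitely many
proper ideals `𝔭ᵢ` containing the homogeneous components of their elements (if no `𝔭ᵢ` were
contained in `𝔮`, a product of components `aᵢ ∈ 𝔭ᵢ ∖ 𝔮` would vanish on `V(𝔮)` without lying in
`𝔮`). [folklore] -/
theorem exists_le_of_projZeros_subset_biUnion {ι : Type*} {s : Finset ι} {𝔭 : ι → Ideal (Rx m)}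
    {𝔮 : Ideal (Rx m)} (h𝔮 : 𝔮.IsPrime)
    (hhom : ∀ i ∈ s, ∀ g ∈ 𝔭 i, ∀ k : ℕ, homogeneousComponent k g ∈ 𝔭 i)
    (htop : ∀ i ∈ s, 𝔭 i ≠ ⊤) (hne : (projZeros 𝔮).Nonempty)
    (hV : projZeros 𝔮 ⊆ ⋃ i ∈ s, projZeros (𝔭 i)) : ∃ i ∈ s, 𝔭 i ≤ 𝔮 := by
  classical
  by_contra hcon
  push Not at hcon
  have hpick : ∀ i ∈ s, ∃ a : Rx m, a ∈ 𝔭 i ∧ a ∉ 𝔮 ∧ constantCoeff a = 0 := by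
    intro i hi
    obtain ⟨g, hg, hg𝔮⟩ := Set.not_subset.mp (hcon i hi)
    obtain ⟨k, hk⟩ := exists_homogeneousComponent_not_mem hg𝔮
    exact ⟨homogeneousComponent k g, hhom i hi g hg k, hk,
      constantCoeff_eq_zero_of_mem (hhom i hi) (htop i hi) (hhom i hi g hg k)⟩
  choose! a ha using hpick
  have hsne : s.Nonempty := by
    obtain ⟨β, hβ⟩ := hne
    obtain ⟨i, hi, -⟩ := Set.mem_iUnion₂.mp (hV hβ)
    exact ⟨i, hi⟩
  have hA𝔮 : (∏ i ∈ s, a i) ∉ 𝔮 := by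
    intro hA
    obtain ⟨i, hi, hmem⟩ := h𝔮.prod_mem_iff.mp hA
    exact (ha i hi).2.1 hmem
  have hA0 : aeval (0 : Fin (m + 1) → ℂ) (∏ i ∈ s, a i) = 0 := by
    obtain ⟨i, hi⟩ := hsne
    rw [map_prod]
    exact Finset.prod_eq_zero hi (by rw [MvPolynomial.aeval_zero, (ha i hi).2.2, map_zero])
  have hAvan : ∀ β ∈ projZeros 𝔮, aeval β (∏ i ∈ s, a i) = 0 := by
    intro β hβ
    obtain ⟨i, hi, hβi⟩ := Set.mem_iUnion₂.mp (hV hβ)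
    rw [map_prod]
    exact Finset.prod_eq_zero hi (hβi.2 _ (ha i hi).1)
  exact hA𝔮 (mem_of_forall_mem_projZeros_aeval_eq_zero h𝔮 hA0 hAvan)

/-! ### Zero sets of decompositions -/

/-- **`V(⋂ᵢ Qᵢ) = ⋃ᵢ V(√Qᵢ)`** for a finite family of ideals with `⋂ Qᵢ = I` (e.g. a primary
decomposition). [folklore] -/
theorem projZeros_eq_biUnion_radical {I : Ideal (Rx m)} {t : Finset (Ideal (Rx m))}
    (ht : t.inf id = I) : projZeros I = ⋃ Q ∈ t, projZeros Q.radical := by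
  classical
  ext β
  simp only [Set.mem_iUnion]
  constructor
  · intro hβ
    by_contra hcon
    push Not at hcon
    -- for each `Q` an element of `√Q` not vanishing at `β`, with a power in `Q`
    have hpick : ∀ Q ∈ t, ∃ g : Rx m, g ∈ Q ∧ aeval β g ≠ 0 := by
      intro Q hQ
      have h1 : β ∉ projZeros Q.radical := hcon Q hQ
      simp only [projZeros, Set.mem_setOf_eq, not_and, not_forall] at h1
      obtain ⟨g, hg, hgβ⟩ := h1 hβ.1
      obtain ⟨e, he⟩ := (Ideal.mem_radical_iff.mp hg)
      refine ⟨g ^ e, he, ?_⟩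
      rw [map_pow]
      exact pow_ne_zero _ hgβ
    choose! g hg using hpick
    have hprod : (∏ Q ∈ t, g Q) ∈ I := by
      rw [← ht]
      refine Submodule.mem_finsetInf.mpr fun Q hQ => ?_
      show (∏ Q' ∈ t, g Q') ∈ (id Q : Ideal (Rx m))
      rw [← Finset.mul_prod_erase t g hQ]
      exact Ideal.mul_mem_right _ _ (hg Q hQ).1
    have hne : aeval β (∏ Q ∈ t, g Q) ≠ 0 := by
      rw [map_prod]
      exact Finset.prod_ne_zero_iff.mpr fun Q hQ => (hg Q hQ).2
    exact hne (hβ.2 _ hprod)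
  · rintro ⟨Q, hQ, hβ⟩
    refine ⟨hβ.1, fun P hP => hβ.2 P ?_⟩
    have hIQ : I ≤ Q := by rw [← ht]; exact Finset.inf_le hQ
    exact Ideal.le_radical (hIQ hP)

/-! ### Ranks: proper inclusions of primes drop the dimension of the quotient -/

/-- If `𝔭 < 𝔮` with `𝔭` prime then `dim R ⧸ 𝔮 + 1 ≤ dim R ⧸ 𝔭` (the image of `𝔮` in the domain
`R ⧸ 𝔭` is a non-zero ideal, `Literature.RingTheory.KrullDimension.ringKrullDim_quotient_add_one_le`).
[folklore] -/
theorem ringKrullDim_quotient_add_one_le_of_lt {R : Type*} [CommRing R] {𝔭 𝔮 : Ideal R}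
    (h𝔭 : 𝔭.IsPrime) (hlt : 𝔭 < 𝔮) : ringKrullDim (R ⧸ 𝔮) + 1 ≤ ringKrullDim (R ⧸ 𝔭) := by
  haveI : IsDomain (R ⧸ 𝔭) := Ideal.Quotient.isDomain 𝔭
  have hne : 𝔮.map (Ideal.Quotient.mk 𝔭) ≠ ⊥ := by
    intro h
    apply not_le_of_gt hlt
    intro x hx
    have hx' : Ideal.Quotient.mk 𝔭 x ∈ 𝔮.map (Ideal.Quotient.mk 𝔭) := Ideal.mem_map_of_mem _ hx
    rw [h, Ideal.mem_bot, Ideal.Quotient.eq_zero_iff_mem] at hx'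
    exact hx'
  have h1 := Literature.RingTheory.KrullDimension.ringKrullDim_quotient_add_one_le hne
  rwa [ringKrullDim_eq_of_ringEquiv (DoubleQuot.quotQuotEquivQuotOfLE hlt.le)] at h1

/-- **Primes of equal finite rank in inclusion are equal**: if `𝔭 ≤ 𝔮` are ideals, `𝔭` prime, and
`dim R ⧸ 𝔭 = dim R ⧸ 𝔮 = d ∈ ℕ`, then `𝔭 = 𝔮`. [folklore] -/
theorem eq_of_le_of_ringKrullDim_quotient_eq {R : Type*} [CommRing R] {𝔭 𝔮 : Ideal R}
    (h𝔭 : 𝔭.IsPrime) (hle : 𝔭 ≤ 𝔮) {d : ℕ} (hp : ringKrullDim (R ⧸ 𝔭) = d)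
    (hq : ringKrullDim (R ⧸ 𝔮) = d) : 𝔭 = 𝔮 := by
  by_contra hne
  have h := ringKrullDim_quotient_add_one_le_of_lt h𝔭 (lt_of_le_of_ne hle hne)
  rw [hp, hq] at h
  have h' : ((d + 1 : ℕ) : WithBot ℕ∞) ≤ ((d : ℕ) : WithBot ℕ∞) := by push_cast; exact h
  have : d + 1 ≤ d := by exact_mod_cast h'
  omega

/-- The same for Nesterenko's rank of primes: `𝔭 ≤ 𝔮`, both prime and `IsUnmixedOfRank · r`, forces
`𝔭 = 𝔮`. [folklore] -/
theorem eq_of_le_of_isUnmixedOfRank {𝔭 𝔮 : Ideal (Rx m)} (h𝔭 : 𝔭.IsPrime) (h𝔮 : 𝔮.IsPrime)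
    (hle : 𝔭 ≤ 𝔮) {r : ℕ} (hp : IsUnmixedOfRank 𝔭 r) (hq : IsUnmixedOfRank 𝔮 r) : 𝔭 = 𝔮 :=
  eq_of_le_of_ringKrullDim_quotient_eq h𝔭 hle (ringKrullDim_quotient_eq_of_isUnmixedOfRank h𝔭 hp)
    (ringKrullDim_quotient_eq_of_isUnmixedOfRank h𝔮 hq)

/-- A proper inclusion of primes `𝔭 < 𝔮` of Nesterenko ranks `r` and `r'` has `r' + 1 ≤ r`.
[folklore] -/
theorem rank_add_one_le_of_lt {𝔭 𝔮 : Ideal (Rx m)} (h𝔭 : 𝔭.IsPrime) (h𝔮 : 𝔮.IsPrime)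
    (hlt : 𝔭 < 𝔮) {r r' : ℕ} (hp : IsUnmixedOfRank 𝔭 r) (hq : IsUnmixedOfRank 𝔮 r') : r' + 1 ≤ r := by
  have h := ringKrullDim_quotient_add_one_le_of_lt h𝔭 hlt
  rw [ringKrullDim_quotient_eq_of_isUnmixedOfRank h𝔭 hp,
    ringKrullDim_quotient_eq_of_isUnmixedOfRank h𝔮 hq] at h
  have h' : ((r' + 1 : ℕ) : WithBot ℕ∞) ≤ ((r : ℕ) : WithBot ℕ∞) := by push_cast; exact h
  exact_mod_cast h'


end PhilipponMain

end Literature.NumberTheory.Transcendental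

end
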